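import Mathlib
import Summits.ValiantsHypothesis.ValiantsHypothesis.Theorems.GeneratorObstructionsPowGenDegreeQPGadgetTableauRecv

/-!
# Route GeneratorObstructions — crux K2 `PowGenDegreeQP` (stmt-ValiantsHypothesis-11655), line
# `trace-side-regimes`: validity of a copy is the `D*` condition `blockExpo = blockTgt`

Step (R2, last part) of the last certificate theorem (`gadgetTab_fiberSum_eq_pow`).  The kind counts
of `valid_labelOf_iff` (…GadgetTableauRecv) are the coordinates of `blockExpo k σ τ` (…BlockCountGen)
for the transported permutations `σ = tripleσ ρ j q`, `τ = pairτ ρ j q`: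

* `blockTgt_apply` — `blockTgt k (ℓ, κ₀) = k` for `κ₀ = B`, `2k` otherwise;
* `blockExpo_apply` — `blockExpo k σ τ (ℓ, κ₀) = #{i | σ i ((dstarTripleLab k i)⁻¹ ℓ) = κ₀}
  + #{i | ∃ r, dstarPairLab k i r = ℓ ∧ castSucc (τ i r) = κ₀}`;
* `card_recvKind_eq` — the same number is `#{s | recvKind ρ j q ℓ s = κ₀}`;
* `valid_copy_iff_blockExpo` — **all three labels of copy `(j,q)` receive the block-`j` monomial iff
  `blockExpo k (tripleσ ρ j q) (pairτ ρ j q) = blockTgt k`**.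

Remaining after this file (R3): regroup the fibrewise sum over (block, copy) with
`sum_pi_prod_fiberwise` (…PiFiberwise) and read off `blockSum k ^ (2^c - 1)`.

Honest framing: combinatorics of one explicit tableau; no stub, crux or summit is settled here;
`VP ≠ VNP` untouched. [folklore]
-/

namespace Summit.ValiantsHypothesis.ValiantsHypothesis.Theorems.GeneratorObstructions.PowGenDegreeQP

open Literature.Computability.AlgebraicComplexity Literature.Computability.AlgebraicComplexity.TableauEval

-- `Summit.ValiantsHypothesis.ValiantsHypothesis.…` is the tree's mandated single-conjunct layout.
set_option linter.dupNamespace false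

noncomputable section

/-! ## §1 Coordinates of `blockTgt` and `blockExpo` -/

/-- Coordinates of the target: `k` on `B`, `2k` on `A'`, `A`. [folklore] -/
theorem blockTgt_apply (k : ℕ) (ℓ κ₀ : Fin 3) :
    blockTgt k (ℓ, κ₀) = if κ₀ = 2 then k else 2 * k := by
  simp only [blockTgt, Finsupp.coe_add, Pi.add_apply, Finsupp.single_apply, Prod.mk.injEq,
    Fin.sum_univ_three]
  rcases fin3_cases ℓ with rfl | rfl | rfl <;> rcases fin3_cases κ₀ with rfl | rfl | rfl <;> simp

/-- A sum of unit singles evaluated at a point counts the indices hitting it. [folklore] -/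
theorem finsuppSum_single_one_apply {ι α : Type*} [DecidableEq α] (s : Finset ι) (f : ι → α)
    (a : α) : (∑ i ∈ s, Finsupp.single (f i) 1 : α →₀ ℕ) a = (s.filter fun i => f i = a).card := by
  classical
  rw [Finsupp.coe_finsetSum, Finset.sum_apply, Finset.card_filter]
  refine Finset.sum_congr rfl fun i _ => ?_
  rw [Finsupp.single_apply]

/-- One triple column contributes `[σ_i((dTL i)⁻¹ ℓ) = κ₀]` at `(ℓ, κ₀)`. [folklore] -/
theorem sum_triple_single_apply (k : ℕ) (σ : Fin (3 * k) → Equiv.Perm (Fin 3)) (i : Fin (3 * k))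
    (ℓ κ₀ : Fin 3) :
    (∑ r : Fin 3, (Finsupp.single (dstarTripleLab k i r, σ i r) 1 : (Fin 3 × Fin 3) →₀ ℕ)) (ℓ, κ₀) =
      if σ i ((dstarTripleLab k i)⁻¹ ℓ) = κ₀ then 1 else 0 := by
  classical
  rw [finsuppSum_single_one_apply]
  have : (Finset.univ.filter fun r : Fin 3 => (dstarTripleLab k i r, σ i r) = (ℓ, κ₀)) =
      (if σ i ((dstarTripleLab k i)⁻¹ ℓ) = κ₀ then {(dstarTripleLab k i)⁻¹ ℓ} else ∅) := by
    ext r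
    simp only [Finset.mem_filter, Finset.mem_univ, true_and, Prod.mk.injEq]
    constructor
    · rintro ⟨h1, h2⟩
      have hr : r = (dstarTripleLab k i)⁻¹ ℓ := by rw [← h1]; simp
      subst hr
      rw [if_pos h2]; exact Finset.mem_singleton_self _
    · intro h
      split_ifs at h with hc
      · rw [Finset.mem_singleton] at h; subst h
        exact ⟨by simp, hc⟩
      · exact absurd h (Finset.notMem_empty _)
  rw [this]; split_ifs <;> simp

/-- The two labels of a pair column are distinct. [folklore] -/
theorem dstarPairLab_injective (k : ℕ) (i : Fin (3 * k)) : Function.Injective (dstarPairLab k i) := by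
  intro a b h
  unfold dstarPairLab at h
  fin_cases a <;> fin_cases b <;> simp_all <;> split_ifs at h <;> simp_all

/-- One pair column contributes `[∃ r, dPL i r = ℓ ∧ castSucc (τ_i r) = κ₀]` at `(ℓ, κ₀)`. [folklore] -/
theorem sum_pair_single_apply (k : ℕ) (τ : Fin (3 * k) → Equiv.Perm (Fin 2)) (i : Fin (3 * k))
    (ℓ κ₀ : Fin 3) :
    (∑ r : Fin 2, (Finsupp.single (dstarPairLab k i r, Fin.castSucc (τ i r)) 1 :
      (Fin 3 × Fin 3) →₀ ℕ)) (ℓ, κ₀) =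
      if ∃ r : Fin 2, dstarPairLab k i r = ℓ ∧ Fin.castSucc (τ i r) = κ₀ then 1 else 0 := by
  classical
  rw [finsuppSum_single_one_apply]
  split_ifs with h
  · obtain ⟨r₀, h1, h2⟩ := h
    rw [Finset.card_eq_one]
    refine ⟨r₀, ?_⟩
    ext r
    simp only [Finset.mem_filter, Finset.mem_univ, true_and, Prod.mk.injEq, Finset.mem_singleton]
    constructor
    · rintro ⟨h3, -⟩
      exact dstarPairLab_injective k i (h3.trans h1.symm)
    · rintro rfl; exact ⟨h1, h2⟩
  · rw [Finset.card_eq_zero, Finset.filter_eq_empty_iff]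
    intro r _ hr
    rw [Prod.mk.injEq] at hr
    exact h ⟨r, hr.1, hr.2⟩

/-- Coordinates of `blockExpo`. [folklore] -/
theorem blockExpo_apply (k : ℕ) (σ : Fin (3 * k) → Equiv.Perm (Fin 3))
    (τ : Fin (3 * k) → Equiv.Perm (Fin 2)) (ℓ κ₀ : Fin 3) :
    blockExpo k σ τ (ℓ, κ₀) =
      (Finset.univ.filter fun i : Fin (3 * k) => σ i ((dstarTripleLab k i)⁻¹ ℓ) = κ₀).card +
      (Finset.univ.filter fun i : Fin (3 * k) =>
        ∃ r : Fin 2, dstarPairLab k i r = ℓ ∧ Fin.castSucc (τ i r) = κ₀).card := by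
  classical
  rw [blockExpo, Finsupp.coe_add, Pi.add_apply, Finsupp.coe_finsetSum, Finset.sum_apply,
    Finsupp.coe_finsetSum, Finset.sum_apply, Finset.card_filter, Finset.card_filter]
  congr 1
  · exact Finset.sum_congr rfl fun i _ => sum_triple_single_apply k σ i ℓ κ₀
  · exact Finset.sum_congr rfl fun i _ => sum_pair_single_apply k τ i ℓ κ₀

/-! ## §2 The kind counts of a label are the coordinates of `blockExpo` -/

variable {σ : Type*}

/-- Splitting a count over `Fin (5k)` at `3k`. [folklore] -/
theorem card_filter_fin_split (k : ℕ) (P : ℕ → Prop) [DecidablePred P] :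
    (Finset.univ.filter fun s : Fin (5 * k) => P s.val).card =
      (Finset.univ.filter fun s : Fin (3 * k) => P s.val).card +
      (Finset.univ.filter fun t : Fin (2 * k) => P (3 * k + t.val)).card := by
  rw [Finset.card_filter, Finset.card_filter, Finset.card_filter,
    Fin.sum_univ_eq_sum_range (fun s => if P s then 1 else 0) (5 * k),
    Fin.sum_univ_eq_sum_range (fun s => if P s then 1 else 0) (3 * k),
    Fin.sum_univ_eq_sum_range (fun t => if P (3 * k + t) then 1 else 0) (2 * k),
    show 5 * k = 3 * k + 2 * k by ring, Finset.sum_range_add]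

/-- The pair part of the count: reindex `t < 2k` by the pair column `pairIdx ℓ t`. [folklore] -/
theorem card_pair_part (k c : ℕ) (hk : 1 ≤ k) (hc : 1 ≤ c) (x : ℕ → σ)
    (ρ : (n : Fin (gadgetTab k c hk hc x).C) → (j : Fin c) →
      Equiv.Perm {r : Fin ((gadgetTab k c hk hc x).h n) // rowBlock k c hk hc x n r = j})
    (j : Fin c) (q : ℕ) (hq : q < 2 ^ j.val) (ℓ κ₀ : Fin 3) :
    (Finset.univ.filter fun t : Fin (2 * k) =>
        Fin.castSucc (pairτ k c hk hc x ρ j q hq ⟨pairIdx k ℓ t.val, pairIdx_lt t.isLt ℓ⟩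
          (pairKind2 k ℓ (pairIdx k ℓ t.val))) = κ₀).card =
      (Finset.univ.filter fun i : Fin (3 * k) =>
        ∃ r : Fin 2, dstarPairLab k i r = ℓ ∧
          Fin.castSucc (pairτ k c hk hc x ρ j q hq i r) = κ₀).card := by
  classical
  -- the injection `t ↦ pairIdx ℓ t`
  let f : Fin (2 * k) → Fin (3 * k) := fun t => ⟨pairIdx k ℓ t.val, pairIdx_lt t.isLt ℓ⟩
  have hf : Function.Injective f := fun a b h => Fin.ext (pairIdx_inj a.isLt b.isLt ℓ
    (congrArg Fin.val h))
  -- the label `ℓ` sits in column `f t` at position `pairKind2`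
  have hlab : ∀ t : Fin (2 * k), dstarPairLab k (f t) (pairKind2 k ℓ (pairIdx k ℓ t.val)) = ℓ := by
    intro t
    have h := pairLabNat_pairIdx t.isLt ℓ
    change pairLabNat k (pairIdx k ℓ t.val) _ = ℓ
    unfold pairKind2 pairKind
    by_cases h0 : pairLabNat k (pairIdx k ℓ t.val) 0 = ℓ
    · simp only [h0, if_true, Fin.val_zero]
      exact h0
    · simp only [h0, if_false, Fin.val_one]
      rcases h with h | h
      · exact absurd h h0
      · exact h
  -- columns containing `ℓ` are exactly the image of `f`
  have himg : ∀ i : Fin (3 * k), (∃ r : Fin 2, dstarPairLab k i r = ℓ) → ∃ t, f t = i := by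
    intro i ⟨r, hr⟩
    -- search `t` by cases on the three column ranges
    have hi := i.isLt
    change pairLabNat k i.val r = ℓ at hr
    unfold pairLabNat at hr
    rcases fin3_cases ℓ with rfl | rfl | rfl
    · -- label 0: columns `[0, 2k)`, position 1
      have hi2 : i.val < 2 * k := by
        by_contra hge
        rw [if_neg (by omega), if_neg (by omega)] at hr
        fin_cases r <;> simp at hr
      refine ⟨⟨i.val, hi2⟩, Fin.ext ?_⟩
      change pairIdx k 0 i.val = i.val; unfold pairIdx; simp
    · -- label 1: columns `[0,k)` (position 0) and `[2k,3k)` (position 1)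
      by_cases h1 : i.val < k
      · refine ⟨⟨i.val, by omega⟩, Fin.ext ?_⟩
        change pairIdx k 1 i.val = i.val; unfold pairIdx; simp [h1]
      · have h2 : 2 * k ≤ i.val := by
          split_ifs at hr <;> fin_cases r <;> simp_all
        refine ⟨⟨i.val - k, by omega⟩, Fin.ext ?_⟩
        change pairIdx k 1 (i.val - k) = i.val; unfold pairIdx
        simp only [Fin.isValue, one_ne_zero, if_false, if_true]
        rw [if_neg (by omega)]; omega
    · -- label 2: columns `[k, 3k)`
      have h2 : k ≤ i.val := by
        split_ifs at hr <;> fin_cases r <;> simp_all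
      refine ⟨⟨i.val - k, by omega⟩, Fin.ext ?_⟩
      change pairIdx k 2 (i.val - k) = i.val; unfold pairIdx
      simp only [Fin.isValue, show (2 : Fin 3) ≠ 0 by decide, show (2 : Fin 3) ≠ 1 by decide, if_false]
      omega
  rw [← Finset.card_image_of_injective _ hf]
  congr 1
  ext i
  simp only [Finset.mem_image, Finset.mem_filter, Finset.mem_univ, true_and]
  constructor
  · rintro ⟨t, ht, rfl⟩
    exact ⟨_, hlab t, ht⟩
  · rintro ⟨r, hr, hκ⟩
    obtain ⟨t, rfl⟩ := himg i ⟨r, hr⟩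
    refine ⟨t, ?_, rfl⟩
    have : r = pairKind2 k ℓ (pairIdx k ℓ t.val) :=
      dstarPairLab_injective k (f t) (hr.trans (hlab t).symm)
    rw [← this]; exact hκ

/-- **The kind counts are the coordinates of `blockExpo`.** [folklore] -/
theorem card_recvKind_eq (k c : ℕ) (hk : 1 ≤ k) (hc : 1 ≤ c) (x : ℕ → σ)
    (ρ : (n : Fin (gadgetTab k c hk hc x).C) → (j : Fin c) →
      Equiv.Perm {r : Fin ((gadgetTab k c hk hc x).h n) // rowBlock k c hk hc x n r = j})
    (j : Fin c) (q : ℕ) (hq : q < 2 ^ j.val) (ℓ κ₀ : Fin 3) :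
    (Finset.univ.filter fun s : Fin (5 * k) => recvKind k c hk hc x ρ j q hq ℓ s = κ₀).card =
      blockExpo k (tripleσ k c hk hc x ρ j q hq) (pairτ k c hk hc x ρ j q hq) (ℓ, κ₀) := by
  classical
  rw [blockExpo_apply]
  -- `recvKind` as a predicate on `ℕ`
  let P : ℕ → Prop := fun s =>
    if hs : s < 3 * k then tripleσ k c hk hc x ρ j q hq ⟨s, hs⟩ ((tripleLabNat k s)⁻¹ ℓ) = κ₀
    else ∃ ht : s - 3 * k < 2 * k, Fin.castSucc (pairτ k c hk hc x ρ j q hq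
      ⟨pairIdx k ℓ (s - 3 * k), pairIdx_lt ht ℓ⟩ (pairKind2 k ℓ (pairIdx k ℓ (s - 3 * k)))) = κ₀
  have hP : ∀ s : Fin (5 * k), (recvKind k c hk hc x ρ j q hq ℓ s = κ₀) ↔ P s.val := by
    intro s
    simp only [P, recvKind]
    split_ifs with hs
    · rfl
    · constructor
      · intro h; exact ⟨by have := s.isLt; omega, h⟩
      · rintro ⟨_, h⟩; exact h
  rw [Finset.filter_congr (fun s _ => hP s), card_filter_fin_split k P]
  congr 1
  · congr 1
    ext i
    simp only [Finset.mem_filter, Finset.mem_univ, true_and, P, dif_pos i.isLt]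
    rfl
  · rw [← card_pair_part k c hk hc x ρ j q hq ℓ κ₀]
    have key : ∀ {a b : ℕ} (ha : a < 2 * k) (hb : b < 2 * k), a = b →
        ((Fin.castSucc (pairτ k c hk hc x ρ j q hq ⟨pairIdx k ℓ a, pairIdx_lt ha ℓ⟩
          (pairKind2 k ℓ (pairIdx k ℓ a))) = κ₀) ↔
         (Fin.castSucc (pairτ k c hk hc x ρ j q hq ⟨pairIdx k ℓ b, pairIdx_lt hb ℓ⟩
          (pairKind2 k ℓ (pairIdx k ℓ b))) = κ₀)) := by
      intro a b ha hb hab; subst hab; exact Iff.rfl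
    congr 1
    ext t
    simp only [Finset.mem_filter, Finset.mem_univ, true_and, P]
    rw [dif_neg (by omega)]
    have e : 3 * k + t.val - 3 * k = t.val := by omega
    constructor
    · rintro ⟨w, h⟩; exact (key w t.isLt e).mp h
    · intro h; exact ⟨by omega, (key (by omega) t.isLt e).mpr h⟩

/-- **Validity of a copy is the `D*` condition.** [folklore] -/
theorem valid_copy_iff_blockExpo [LinearOrder σ] (k c : ℕ) (hk : 1 ≤ k) (hc : 1 ≤ c) (x : ℕ → σ)
    {N : ℕ} (hx : IsAntitoneEnum x N) (hN : 3 * c ≤ N)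
    (ρ : (n : Fin (gadgetTab k c hk hc x).C) → (j : Fin c) →
      Equiv.Perm {r : Fin ((gadgetTab k c hk hc x).h n) // rowBlock k c hk hc x n r = j})
    (j : Fin c) (q : ℕ) (hq : q < 2 ^ j.val) :
    (∀ ℓ : Fin 3, (gadgetTab k c hk hc x).content (fiberPermPi (rowBlock k c hk hc x) ρ)
        ⟨labelOf j q ℓ, labelOf_lt j.isLt hq ℓ⟩ =
      gadgetExp k (fun i : Fin c => x (letterRow c i 2)) (fun i => x (letterRow c i 1))
        (fun i => x (letterRow c i 0)) j) ↔
      blockExpo k (tripleσ k c hk hc x ρ j q hq) (pairτ k c hk hc x ρ j q hq) = blockTgt k := by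
  classical
  constructor
  · intro h
    ext p
    obtain ⟨ℓ, κ₀⟩ := p
    rw [← card_recvKind_eq, (valid_labelOf_iff k c hk hc x hx hN ρ j q hq ℓ).mp (h ℓ) κ₀,
      blockTgt_apply]
  · intro h ℓ
    exact (valid_labelOf_iff k c hk hc x hx hN ρ j q hq ℓ).mpr fun κ₀ => by
      rw [card_recvKind_eq, h, blockTgt_apply]

end

end Summit.ValiantsHypothesis.ValiantsHypothesis.Theorems.GeneratorObstructions.PowGenDegreeQP
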